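import Mathlib.Analysis.Calculus.ImplicitFunction.ProdDomain
import Literature.Geometry.Riemannian.GurskyViaclovskyOpenness
import Literature.Geometry.Riemannian.Sigma2ConformalFour
import Literature.Geometry.Riemannian.ChangGurskyYangSmoothness
import Literature.Geometry.Riemannian.CkNecks
import Literature.Geometry.Lorentzian.WeylConformal
import Literature.Geometry.Lorentzian.ConformalChangeRicci
import Literature.Geometry.Lorentzian.LeviCivitaProofs
import HarnessLib

/-!
# Gursky–Viaclovsky openness: the weighted path equation on the background metric, and the
# formal skeleton of the openness step (implicit function theorem, persistence of admissibility)

Support file (everything PROVED; two definitions with bodies, no named fact) for the named fact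
`Literature.Geometry.Riemannian.gurskyViaclovsky_pathOpen_weighted_four`
(`GurskyViaclovskyOpenness.lean`; Gursky–Viaclovsky 2003, Prop. 2 and §5: the solvable set `𝒮` of
the `σ₂` continuity path is open). The printed proof (J. Differential Geom. 63 (2003),
arXiv:math/0301350) has three moves, and this file lands the parts of them that the tree can carry
today, in the order of the paper:

1. **§1, (change1)–(PDE): the equation on the background.** "Using (change1), we may write (eqn1)
   with respect to the background metric `g`": for `h = e^{2w} g` (`w = −u`) the tree's conformal
   laws — `exp_mul_sigma2WeylSchouten_conformal_exp` (`σ₂(A)`, `Sigma2ConformalFour.lean`),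
   `weylNormSq_conformal_sq` (`|W|²`, `Lorentzian/WeylConformal.lean`) and
   `scalarCurvature_conformal_exp_four` (`R`, `Lorentzian/ConformalChangeRicci.lean`) — turn the
   weighted path equation `pathOperator h t = q e^{8u}` of `GurskyViaclovskyPath.lean` into a scalar
   equation for `w` on `(M, g)`:
   * `backgroundScalar g w = R_g − 6Δ_g w − 6|dw|²_g` (`= e^{2w} R_h`) and
     `backgroundPathOperator g t w` (`= e^{4w}·pathOperator h t`, definitions with bodies);
   * `exp_mul_pathOperator_eq_backgroundPathOperator`, `scalarCurvature_eq_backgroundScalar`;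
   * `IsPathSolution.backgroundPathOperator_eq`, `IsPathSolution.backgroundScalar_pos` (a path
     solution solves the background equation `backgroundPathOperator g t w = q e^{−4w}` with
     `backgroundScalar g w > 0`), `solvable_of_background` (conversely, a smooth `w` solving it with
     `backgroundScalar g w > 0` gives `t ∈ 𝒮`, the conformal metric being `g.confSmul e^{2w}`), and
     the dictionary `solvable_iff_exists_background`.
2. **§5, "the implicit function theorem (see [GT]) implies that `𝒮` is open"**: the abstract
   Banach-space step, from Mathlib's `HasStrictFDerivAt.implicitFunctionOfProdDomain`:
   `exists_solution_nhds_of_hasStrictFDerivAt` (a zero `(t₀, w₀)` of `Φ : ℝ × X → Y` with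
   invertible `∂_w Φ` propagates to a family `t ↦ w_t`, `w_t → w₀`, of zeros for `t` near `t₀`).
3. **Admissibility persists** (`A^t_{u_t} ∈ Γ₂⁺` near `t₀`; in the tree's vocabulary `R_{h_t} > 0`,
   i.e. `backgroundScalar g w_t > 0`): `eventually_forall_pos_of_tendstoUniformly` (a continuous
   positive function on a compact space stays positive under uniform perturbation), and the
   assembly `solvable_eventually_of_background_family` / `exists_Ioo_of_eventually_nhds`, which
   turn a family of smooth background solutions `w_t` with `backgroundScalar g w_t → backgroundScalar
   g w₀` uniformly into `Solvable g t q` for all `t` in an interval around `t₀`.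
4. **Regularity bookkeeping of `F_t`**: `contMDiff_backgroundPathOperator` (`F_t` maps `C^∞` to
   `C^∞`, through `contMDiff_pathOperator` of the conformal metric), and its `t`-dependence
   `backgroundPathOperator_eq_add_sub` (a quadratic polynomial in `t`),
   `hasDerivAt_backgroundPathOperator_param`, `tendstoUniformly_backgroundPathOperator`.

The linearisation in `w` (Prop. 2: `𝓛^t`, its ellipticity and the injectivity `Ker 𝓛^t ∩ C² = 0`)
is `GurskyViaclovskyLinearisation.lean`.

## What is NOT here (the analytic core; why the fact is not discharged)

The remaining content of Prop. 2 + §5 is Hölder-space elliptic theory on a closed manifold, absent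
from Mathlib and from the tree: (a) Banach spaces `C^{2,α}(M) ↪ C²(M)`, `C^α(M)` in which
`w ↦ backgroundPathOperator g t w − q e^{−4w}` is a `C¹` map; (b) GV Prop. 2: its linearisation
`𝓛^t φ = L^t(g⁻¹A^t_u)_{ij}∇_{ij}φ + ⋯ − 4f²e^{4u}φ`, elliptic for `A^t_u ∈ Γ₂⁺`, `t ≤ 1`
(Prop. 1 (ii)) with negative zeroth-order term, is an isomorphism `C^{2,α} → C^α` (maximum
principle + Schauder theory, "see [GT]"); (c) "classical elliptic regularity": `C^{2,α}` solutions
are `C^∞`. Given (a)–(c), items 2–3 above and `solvable_iff_exists_background` assemble the fact.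

## References

* M. J. Gursky, J. A. Viaclovsky, *A fully nonlinear equation on four-manifolds with positive
  scalar curvature*, J. Differential Geom. 63 (2003) 131–154, arXiv:math/0301350: §1
  ((change1), (PDE)), §2 (Def. 1, Props. 1–2), §5 (the set `𝒮`, proof of Thm. 1).
  [GurskyViaclovsky2003]
* D. Gilbarg, N. S. Trudinger, *Elliptic partial differential equations of second order* (2001),
  Thm. 17.6 (implicit function theorem). [GilbargTrudinger2001]
* A. L. Besse, *Einstein Manifolds* (1987), Thm. 1.159 (conformal changes). [Besse1987]
-/

noncomputable section

open scoped Manifold ContDiff Topology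
open Set Filter Module

namespace Literature.Geometry.Riemannian.GurskyViaclovskyPath

open Literature.Geometry.Lorentzian (PseudoRiemannianMetric)
open Literature.Geometry.Lorentzian.PseudoRiemannianMetric

/-! ### §1 of the paper: the weighted path equation written on the background metric -/

section Dictionary

variable {M : Type*} [TopologicalSpace M] [ChartedSpace (EuclideanSpace ℝ (Fin 4)) M]
  [IsManifold (𝓡 4) ∞ M]

/-- **The scalar curvature of `h = e^{2w} g` read on the background**:
`backgroundScalar g w = R_g − 6 Δ_g w − 6 g⁻¹(dw, dw)`, so that `R_h = e^{−2w}·backgroundScalar g w`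
(`scalarCurvature_eq_backgroundScalar`; Besse 1987, Thm. 1.159 (f) with `n = 4`). With `w = −u`
this is Gursky–Viaclovsky's `6 e^{2u}·σ₁(g⁻¹A¹_u) = R_g + 6Δ_g u − 6|∇u|²` (§1, trace of
(change1)); its positivity is the admissibility clause `R_h > 0` of `IsPathSolution`.
[cite: GurskyViaclovsky2003, §1 (change1)] [cite: Besse1987, Thm. 1.159] -/
def backgroundScalar
    (g : PseudoRiemannianMetric (𝓡 4) ∞ (EuclideanSpace ℝ (Fin 4)) (TangentSpace (𝓡 4) : M → Type _))
    [g.HasLeviCivita] (w : M → ℝ) (x : M) : ℝ :=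
  g.scalarCurvature x - 6 * g.dalembertian w x - 6 * g.gradSq w x

/-- **The Weyl-weighted path operator of `h = e^{2w} g` read on the background**
(`= e^{4w}·pathOperator h t`, `exp_mul_pathOperator_eq_backgroundPathOperator`): the pointwise law
of `σ₂(A)` under `g ↦ e^{2w} g` in dimension four (`exp_mul_sigma2WeylSchouten_conformal_exp`:
`e^{4w}σ₂(A_h) = σ₂(A_g) + [2⟨Ric_g, Hess_g w⟩ − R_g Δ_g w] + 2[(Δ_g w)² − |Hess_g w|² − Ric_g(∇w,∇w)]
+ 2[Δ_g w·|dw|² + 2Hess_g w(∇w,∇w)]`), minus `¼|W_g|²_g = ¼e^{4w}|W_h|²_h`, plus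
`(1−t)(2−t)(backgroundScalar g w)²/6 = e^{4w}(1−t)(2−t)R_h²/6`. With `w = −u` this is
`4e^{−4u}·[σ₂(g⁻¹A^t_u) − (1/16)|W_g|²_g]` for Gursky–Viaclovsky's `A^t_u = A^t_g + ∇²u +
((1−t)/2)(Δu)g + du⊗du − ((2−t)/2)|∇u|²g` (§1, (change1)–(PDE); module docstring "Dictionary" of
`GurskyViaclovskyPath.lean`): the weighted path equation on the background is
`backgroundPathOperator g t w = q·e^{−4w}` (`IsPathSolution.backgroundPathOperator_eq`).
[cite: GurskyViaclovsky2003, §1 (change1)–(PDE)] [cite: ChangGurskyYang2003, (1.10)] -/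
def backgroundPathOperator
    (g : PseudoRiemannianMetric (𝓡 4) ∞ (EuclideanSpace ℝ (Fin 4)) (TangentSpace (𝓡 4) : M → Type _))
    [g.HasLeviCivita] (t : ℝ) (w : M → ℝ) (x : M) : ℝ :=
  (g.sigma2WeylSchouten x
      + (2 * g.innerBilin x (g.ricci x) (g.hessian w x) - g.scalarCurvature x * g.dalembertian w x)
      + 2 * (g.dalembertian w x ^ 2 - g.normSq x (g.hessian w x)
          - g.ricci x (g.sharp x (mvfderiv (𝓡 4) w x).toLinearMap)
              (g.sharp x (mvfderiv (𝓡 4) w x).toLinearMap))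
      + 2 * (g.dalembertian w x * g.gradSq w x
          + 2 * g.hessian w x (g.sharp x (mvfderiv (𝓡 4) w x).toLinearMap)
              (g.sharp x (mvfderiv (𝓡 4) w x).toLinearMap)))
    - 1 / 4 * g.weylNormSq x
    + (1 - t) * (2 - t) * backgroundScalar g w x ^ 2 / 6

variable
  (g h : PseudoRiemannianMetric (𝓡 4) ∞ (EuclideanSpace ℝ (Fin 4)) (TangentSpace (𝓡 4) : M → Type _))
  [g.HasLeviCivita] [h.HasLeviCivita]

/-- `t` enters the background operator only through the correction `(1−t)(2−t)ρ²/6`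
(Gursky–Viaclovsky 2003, proof of Prop. 4: `σ₂(A^t) = σ₂(A¹) + (3/2)(1−t)(2−t)σ₁(A¹)²`).
[cite: GurskyViaclovsky2003, proof of Prop. 4] -/
theorem backgroundPathOperator_eq_one_add (t : ℝ) (w : M → ℝ) (x : M) :
    backgroundPathOperator g t w x =
      backgroundPathOperator g 1 w x + (1 - t) * (2 - t) * backgroundScalar g w x ^ 2 / 6 := by
  simp only [backgroundPathOperator]
  ring

/-- `backgroundScalar g w` is `C^∞` for `C^∞` data (`contMDiff_scalarCurvature`,
`contMDiff_dalembertian`, `contMDiff_gradSq`). [folklore] -/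
theorem contMDiff_backgroundScalar {w : M → ℝ} (hw : ContMDiff (𝓡 4) 𝓘(ℝ) ∞ w) :
    ContMDiff (𝓡 4) 𝓘(ℝ) ∞ (backgroundScalar g w) :=
  ((contMDiff_scalarCurvature g).sub (contMDiff_const.mul (contMDiff_dalembertian g hw))).sub
    (contMDiff_const.mul (contMDiff_gradSq g hw))

/-- **`R_h = e^{−2w}(R_g − 6Δ_g w − 6|dw|²_g)` for `h = e^{2w} g` in dimension four** (Besse 1987,
Thm. 1.159 (f); the tree's `scalarCurvature_conformal_exp_four` with `|dw|²_g = gradSq`).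
[cite: Besse1987, Thm. 1.159] -/
theorem scalarCurvature_eq_backgroundScalar {w : M → ℝ} (hw : ContMDiff (𝓡 4) 𝓘(ℝ) ∞ w)
    (hgh : ∀ (x : M) (v v' : TangentSpace (𝓡 4) x), h.val x v v' = Real.exp (2 * w x) * g.val x v v')
    (x : M) :
    h.scalarCurvature x = (Real.exp (2 * w x))⁻¹ * backgroundScalar g w x := by
  have h4 : finrank ℝ (EuclideanSpace ℝ (Fin 4)) = 4 := finrank_euclideanSpace_fin
  rw [scalarCurvature_conformal_exp_four g h h4 hw hgh x, backgroundScalar, gradSq]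

/-- **`|W_h|²_h = e^{−4w}|W_g|²_g` for `h = e^{2w} g`** (`weylNormSq_conformal_sq` with `ψ = e^{w}`;
Besse 1987, Thm. 1.159 (c)). [cite: Besse1987, Thm. 1.159] -/
theorem weylNormSq_eq_exp_neg_mul (hg : g.IsRiemannian) {w : M → ℝ}
    (hw : ContMDiff (𝓡 4) 𝓘(ℝ) ∞ w)
    (hgh : ∀ (x : M) (v v' : TangentSpace (𝓡 4) x), h.val x v v' = Real.exp (2 * w x) * g.val x v v')
    (x : M) :
    h.weylNormSq x = (Real.exp (4 * w x))⁻¹ * g.weylNormSq x := by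
  have h3 : 3 ≤ finrank ℝ (EuclideanSpace ℝ (Fin 4)) := by
    rw [finrank_euclideanSpace_fin]; norm_num
  have hψ : ContMDiff (𝓡 4) 𝓘(ℝ) ∞ (fun x ↦ Real.exp (w x)) :=
    Real.contDiff_exp.comp_contMDiff hw
  have hpos : ∀ x : M, 0 < Real.exp (w x) := fun x ↦ Real.exp_pos _
  have hgh' : ∀ (x : M) (v v' : TangentSpace (𝓡 4) x),
      h.val x v v' = Real.exp (w x) ^ 2 * g.val x v v' := fun x v v' ↦ by
    rw [hgh x v v', ← Real.exp_nat_mul]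
    norm_num
  rw [weylNormSq_conformal_sq h3 g h hg hψ hpos hgh' x, ← Real.exp_nat_mul]
  norm_num

/-- **The path operator of `h = e^{2w} g` read on the background**:
`e^{4w(x)}·pathOperator h t x = backgroundPathOperator g t w x` — the three conformal laws
(`σ₂(A)`, `|W|²`, `R`) assembled; Gursky–Viaclovsky 2003, §1: "Using (change1), we may write
(eqn1) with respect to the background metric `g`" (there without the Weyl term and before
multiplying by `4e^{4u}`). [cite: GurskyViaclovsky2003, §1 (change1)–(PDE)] -/
theorem exp_mul_pathOperator_eq_backgroundPathOperator (hg : g.IsRiemannian) {w : M → ℝ}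
    (hw : ContMDiff (𝓡 4) 𝓘(ℝ) ∞ w)
    (hgh : ∀ (x : M) (v v' : TangentSpace (𝓡 4) x), h.val x v v' = Real.exp (2 * w x) * g.val x v v')
    (t : ℝ) (x : M) :
    Real.exp (4 * w x) * pathOperator h t x = backgroundPathOperator g t w x := by
  have hσ := exp_mul_sigma2WeylSchouten_conformal_exp g h hg hw hgh x
  have hW := weylNormSq_eq_exp_neg_mul g h hg hw hgh x
  have hR := scalarCurvature_eq_backgroundScalar g h hw hgh x
  have h2 : Real.exp (2 * w x) ≠ 0 := (Real.exp_pos _).ne'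
  have h4 : Real.exp (4 * w x) = Real.exp (2 * w x) ^ 2 := by
    rw [← Real.exp_nat_mul]
    congr 1
    push_cast
    ring
  have hexpand : Real.exp (4 * w x) * pathOperator h t x =
      Real.exp (4 * w x) * h.sigma2WeylSchouten x
        - 1 / 4 * (Real.exp (4 * w x) * h.weylNormSq x)
        + (1 - t) * (2 - t) * (Real.exp (4 * w x) * h.scalarCurvature x ^ 2) / 6 := by
    simp only [pathOperator]
    ring
  rw [hexpand, hσ, hW, hR]
  simp only [backgroundPathOperator, h4]
  field_simp

variable {g h}

/-- **A path solution solves the background equation** `backgroundPathOperator g t w = q·e^{−4w}`,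
`w = −u` (multiply `pathOperator h t = q e^{8u}` by `e^{4w} = e^{−4u}`).
[cite: GurskyViaclovsky2003, §1 (PDE) and §5 (the set 𝒮)] -/
theorem IsPathSolution.backgroundPathOperator_eq {u : M → ℝ} {t : ℝ} {q : M → ℝ}
    (hs : IsPathSolution g h u t q) (x : M) :
    backgroundPathOperator g t (fun y ↦ -u y) x = q x * Real.exp (-4 * (-u x)) := by
  have hgh : ∀ (y : M) (v v' : TangentSpace (𝓡 4) y),
      h.val y v v' = Real.exp (2 * (-u y)) * g.val y v v' := fun y v v' ↦ by
    rw [hs.val_eq y v v']; ring_nf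
  rw [← exp_mul_pathOperator_eq_backgroundPathOperator g h hs.isRiemannian_background
    hs.contMDiff.neg hgh t x, hs.pathOperator_eq x, mul_left_comm, ← Real.exp_add]
  ring_nf

/-- **A path solution is admissible on the background**: `backgroundScalar g (−u) > 0`
(`= e^{−2u} R_h`, and `R_h > 0`). [cite: GurskyViaclovsky2003, §5 (the set 𝒮) and Def. 1] -/
theorem IsPathSolution.backgroundScalar_pos {u : M → ℝ} {t : ℝ} {q : M → ℝ}
    (hs : IsPathSolution g h u t q) (x : M) :
    0 < backgroundScalar g (fun y ↦ -u y) x := by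
  have hgh : ∀ (y : M) (v v' : TangentSpace (𝓡 4) y),
      h.val y v v' = Real.exp (2 * (-u y)) * g.val y v v' := fun y v v' ↦ by
    rw [hs.val_eq y v v']; ring_nf
  have hR := hs.scalarCurvature_pos x
  rw [scalarCurvature_eq_backgroundScalar g h hs.contMDiff.neg hgh x] at hR
  exact pos_of_mul_pos_right hR (inv_pos.2 (Real.exp_pos _)).le

variable (g)

/-- **From a background solution to `t ∈ 𝒮`.** If `w ∈ C^∞(M)` solves
`backgroundPathOperator g t w = q e^{−4w}` with `backgroundScalar g w > 0` on a Riemannian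
background `g`, then the conformal metric `h = e^{2w} g` (`PseudoRiemannianMetric.confSmul`, with
its Levi-Civita connection `PseudoRiemannianMetric.hasLeviCivita`) and `u = −w` form a smooth
admissible solution of the weighted path equation at `t`: `Solvable g t q`. This is the converse
reading of Gursky–Viaclovsky's "(eqn1) ⟺ (PDE)" (§1). [cite: GurskyViaclovsky2003, §1 (change1)–(PDE)] -/
theorem solvable_of_background (hg : g.IsRiemannian) {t : ℝ} {q : M → ℝ} {w : M → ℝ}
    (hw : ContMDiff (𝓡 4) 𝓘(ℝ) ∞ w) (hpos : ∀ x, 0 < backgroundScalar g w x)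
    (heq : ∀ x, backgroundPathOperator g t w x = q x * Real.exp (-4 * w x)) :
    Solvable g t q := by
  have hexp : ContMDiff (𝓡 4) 𝓘(ℝ, ℝ) ∞ (fun x ↦ Real.exp (2 * w x)) :=
    Real.contDiff_exp.comp_contMDiff (contMDiff_const.mul hw)
  have hexp_pos : ∀ x : M, 0 < Real.exp (2 * w x) := fun x ↦ Real.exp_pos _
  set h := g.confSmul (fun x ↦ Real.exp (2 * w x)) hexp fun x ↦ (hexp_pos x).ne' with hh
  haveI : h.HasLeviCivita := h.hasLeviCivita
  have hgh : ∀ (x : M) (v v' : TangentSpace (𝓡 4) x),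
      h.val x v v' = Real.exp (2 * w x) * g.val x v v' := fun x v v' ↦ by
    rw [hh, confSmul_apply]
  refine ⟨h, this, fun x ↦ -w x, hg.confSmul hexp hexp_pos, hw.neg, fun x v v' ↦ ?_,
    fun x ↦ ?_, fun x ↦ ?_⟩
  · rw [hgh x v v']; ring_nf
  · rw [scalarCurvature_eq_backgroundScalar g h hw hgh x]
    exact mul_pos (inv_pos.2 (hexp_pos x)) (hpos x)
  · have h4 : Real.exp (4 * w x) ≠ 0 := (Real.exp_pos _).ne'
    have key := exp_mul_pathOperator_eq_backgroundPathOperator g h hg hw hgh t x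
    rw [heq x] at key
    apply mul_left_cancel₀ h4
    rw [key, mul_left_comm, ← Real.exp_add]
    ring_nf

/-- **Dictionary `𝒮 ⟷` background equation** (Gursky–Viaclovsky 2003, §1 and §5, for the weighted
path read on the conformal metric): on a Riemannian background, `t ∈ 𝒮` (`Solvable g t q`) iff
some `w ∈ C^∞(M)` solves `backgroundPathOperator g t w = q e^{−4w}` with `backgroundScalar g w > 0`
pointwise (then `h = e^{2w} g`, `u = −w`). [cite: GurskyViaclovsky2003, §1 (change1)–(PDE), §5 (the set 𝒮)] -/
theorem solvable_iff_exists_background (hg : g.IsRiemannian) (t : ℝ) (q : M → ℝ) :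
    Solvable g t q ↔ ∃ w : M → ℝ, ContMDiff (𝓡 4) 𝓘(ℝ) ∞ w ∧ (∀ x, 0 < backgroundScalar g w x) ∧
      ∀ x, backgroundPathOperator g t w x = q x * Real.exp (-4 * w x) := by
  constructor
  · rintro ⟨h, _i, u, hs⟩
    exact ⟨fun y ↦ -u y, hs.contMDiff.neg, hs.backgroundScalar_pos, hs.backgroundPathOperator_eq⟩
  · rintro ⟨w, hw, hpos, heq⟩
    exact solvable_of_background g hg hw hpos heq

end Dictionary

/-! ### §5 of the paper: the implicit function theorem step, abstractly -/

section ImplicitFunction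

variable {X : Type*} [NormedAddCommGroup X] [NormedSpace ℝ X] [CompleteSpace X]
  {Y : Type*} [NormedAddCommGroup Y] [NormedSpace ℝ Y] [CompleteSpace Y]

/-- **"The implicit function theorem (see [GT]) implies that `𝒮` is open"** — the Banach-space
skeleton of Gursky–Viaclovsky 2003, §5 (Gilbarg–Trudinger 2001, Thm. 17.6), from Mathlib's
`HasStrictFDerivAt.implicitFunctionOfProdDomain`: if `Φ : ℝ × X → Y` (parameter `t`, unknown `w`)
is strictly differentiable at a zero `(t₀, w₀)` and its partial derivative in `w` there is
invertible, then there is a family `t ↦ w_t` with `w_t → w₀` as `t → t₀` and `Φ(t, w_t) = 0` for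
all `t` near `t₀`. [cite: GilbargTrudinger2001, Thm. 17.6] -/
theorem exists_solution_nhds_of_hasStrictFDerivAt {Φ : ℝ × X → Y} {Φ' : ℝ × X →L[ℝ] Y}
    {t₀ : ℝ} {w₀ : X} (hΦ : HasStrictFDerivAt Φ Φ' (t₀, w₀))
    (hinv : (Φ' ∘L ContinuousLinearMap.inr ℝ ℝ X).IsInvertible) (h0 : Φ (t₀, w₀) = 0) :
    ∃ ψ : ℝ → X, Tendsto ψ (𝓝 t₀) (𝓝 w₀) ∧ ∀ᶠ t in 𝓝 t₀, Φ (t, ψ t) = 0 := by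
  refine ⟨hΦ.implicitFunctionOfProdDomain hinv, hΦ.tendsto_implicitFunctionOfProdDomain hinv, ?_⟩
  have h := hΦ.eventually_apply_implicitFunctionOfProdDomain hinv
  rw [h0] at h
  exact h

end ImplicitFunction

/-! ### Persistence of admissibility and the assembly of the openness step -/

section Persistence

/-- **A positive continuous function on a compact space stays positive under uniform
perturbation**: if `F i → f` uniformly along `l`, `f` continuous and `f > 0` everywhere on a
compact space, then eventually `F i > 0` everywhere. (The step "`A^t_{u_t} ∈ Γ₂⁺` for `t` near
`t₀`" of the continuity method, Gursky–Viaclovsky 2003, §5, in the tree's admissibility vocabulary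
`R_{h_t} > 0`.) [folklore] -/
theorem eventually_forall_pos_of_tendstoUniformly {ι Z : Type*} [TopologicalSpace Z]
    [CompactSpace Z] {F : ι → Z → ℝ} {f : Z → ℝ} {l : Filter ι} (hf : Continuous f)
    (hpos : ∀ z, 0 < f z) (hF : TendstoUniformly F f l) : ∀ᶠ i in l, ∀ z, 0 < F i z := by
  rcases isEmpty_or_nonempty Z with hZ | hZ
  · exact Eventually.of_forall fun i z ↦ (IsEmpty.false z).elim
  · obtain ⟨z₀, -, hz₀⟩ := isCompact_univ.exists_isMinOn univ_nonempty hf.continuousOn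
    have hm : 0 < f z₀ := hpos z₀
    filter_upwards [Metric.tendstoUniformly_iff.1 hF (f z₀) hm] with i hi z
    have h1 : f z₀ ≤ f z := hz₀ (mem_univ z)
    have h2 := hi z
    rw [Real.dist_eq, abs_sub_lt_iff] at h2
    linarith [h2.1]

/-- From an `∀ᶠ t in 𝓝 t₀` statement to an explicit symmetric interval `(t₀ − ε, t₀ + ε)` (the
shape of the conclusion of `gurskyViaclovsky_pathOpen_weighted_four`). [folklore] -/
theorem exists_Ioo_of_eventually_nhds {P : ℝ → Prop} {t₀ : ℝ} (h : ∀ᶠ t in 𝓝 t₀, P t) :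
    ∃ ε : ℝ, 0 < ε ∧ ∀ t : ℝ, t₀ - ε < t → t < t₀ + ε → P t := by
  obtain ⟨ε, hε, hball⟩ := Metric.eventually_nhds_iff.1 h
  refine ⟨ε, hε, fun t h1 h2 ↦ hball ?_⟩
  rw [Real.dist_eq, abs_sub_lt_iff]
  constructor <;> linarith

variable {M : Type*} [TopologicalSpace M] [ChartedSpace (EuclideanSpace ℝ (Fin 4)) M]
  [IsManifold (𝓡 4) ∞ M] [CompactSpace M]
  (g : PseudoRiemannianMetric (𝓡 4) ∞ (EuclideanSpace ℝ (Fin 4)) (TangentSpace (𝓡 4) : M → Type _))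
  [g.HasLeviCivita]

/-- **Assembly of the openness step from a family of background solutions.** On a compact `M`
with Riemannian background `g`: if `t ↦ w_t` are, for `t` near `t₀`, smooth solutions of the
background equation `backgroundPathOperator g t w_t = q e^{−4w_t}`, if `backgroundScalar g w_t →
backgroundScalar g w₀` uniformly as `t → t₀` for a smooth `w₀` with `backgroundScalar g w₀ > 0`
(e.g. the background solution at `t₀`, `IsPathSolution.backgroundScalar_pos`), then `t ∈ 𝒮` for
all `t` near `t₀` (`solvable_of_background` + `eventually_forall_pos_of_tendstoUniformly`). The analytic core of Gursky–Viaclovsky's Prop. 2 +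
§5 (Schauder invertibility of `𝓛^t`, the implicit function theorem in `C^{2,α}`, elliptic
regularity) is exactly what produces such a family from one solution `w₀` at `t₀ ≤ 1`; it is NOT
proved in the tree. [cite: GurskyViaclovsky2003, §5 (proof of Thm. 1)] -/
theorem solvable_eventually_of_background_family (hg : g.IsRiemannian) {t₀ : ℝ} {q : M → ℝ}
    {w₀ : M → ℝ} (hw₀ : ContMDiff (𝓡 4) 𝓘(ℝ) ∞ w₀)
    (hpos : ∀ x, 0 < backgroundScalar g w₀ x) {ψ : ℝ → M → ℝ}
    (hsmooth : ∀ᶠ t in 𝓝 t₀, ContMDiff (𝓡 4) 𝓘(ℝ) ∞ (ψ t))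
    (heq : ∀ᶠ t in 𝓝 t₀, ∀ x, backgroundPathOperator g t (ψ t) x = q x * Real.exp (-4 * ψ t x))
    (hunif : TendstoUniformly (fun t ↦ backgroundScalar g (ψ t)) (backgroundScalar g w₀) (𝓝 t₀)) :
    ∀ᶠ t in 𝓝 t₀, Solvable g t q := by
  filter_upwards [hsmooth, heq, eventually_forall_pos_of_tendstoUniformly
    (contMDiff_backgroundScalar g hw₀).continuous hpos hunif] with t ht₁ ht₂ ht₃
  exact solvable_of_background g hg ht₁ ht₃ ht₂

end Persistence

/-! ### The background operator is a smooth function of `x` and a quadratic polynomial in `t` -/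

section Smoothness

variable {M : Type*} [TopologicalSpace M] [ChartedSpace (EuclideanSpace ℝ (Fin 4)) M]
  [IsManifold (𝓡 4) ∞ M]
  (g : PseudoRiemannianMetric (𝓡 4) ∞ (EuclideanSpace ℝ (Fin 4)) (TangentSpace (𝓡 4) : M → Type _))
  [g.HasLeviCivita]

/-- **`F_t` maps `C^∞` to `C^∞`**: for a smooth `w` on a Riemannian background the function
`x ↦ backgroundPathOperator g t w x` is smooth — it is `e^{4w}·P_t(e^{2w} g)`
(`exp_mul_pathOperator_eq_backgroundPathOperator`) and the curvature quantities of the smooth metric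
`e^{2w} g` are smooth (`contMDiff_pathOperator`, `ChangGurskyYangSmoothness.lean`). This is the
regularity bookkeeping "since `f ∈ C^∞(M)` … `u_t ∈ C^∞(M)`" of §5 read on the background.
[cite: GurskyViaclovsky2003, §5] -/
theorem contMDiff_backgroundPathOperator (hg : g.IsRiemannian) {w : M → ℝ}
    (hw : ContMDiff (𝓡 4) 𝓘(ℝ) ∞ w) (t : ℝ) :
    ContMDiff (𝓡 4) 𝓘(ℝ) ∞ fun x ↦ backgroundPathOperator g t w x := by
  have hexp : ContMDiff (𝓡 4) 𝓘(ℝ, ℝ) ∞ (fun x ↦ Real.exp (2 * w x)) :=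
    Real.contDiff_exp.comp_contMDiff (contMDiff_const.mul hw)
  have hexp_pos : ∀ x : M, 0 < Real.exp (2 * w x) := fun x ↦ Real.exp_pos _
  set h := g.confSmul (fun x ↦ Real.exp (2 * w x)) hexp fun x ↦ (hexp_pos x).ne' with hh
  haveI : h.HasLeviCivita := h.hasLeviCivita
  have hgh : ∀ (x : M) (v v' : TangentSpace (𝓡 4) x),
      h.val x v v' = Real.exp (2 * w x) * g.val x v v' := fun x v v' ↦ by
    rw [hh, confSmul_apply]
  have hfun : (fun x ↦ backgroundPathOperator g t w x) =
      fun x ↦ Real.exp (4 * w x) * pathOperator h t x :=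
    funext fun x ↦ (exp_mul_pathOperator_eq_backgroundPathOperator g h hg hw hgh t x).symm
  rw [hfun]
  exact (Real.contDiff_exp.comp_contMDiff (contMDiff_const.mul hw)).mul
    (contMDiff_pathOperator h (hg.confSmul hexp hexp_pos) t)

/-- **`F_t` is a quadratic polynomial in `t`**: `backgroundPathOperator g t w =
backgroundPathOperator g t₀ w + ((1−t)(2−t) − (1−t₀)(2−t₀))·ρ_w²/6` pointwise. [folklore] -/
theorem backgroundPathOperator_eq_add_sub (t t₀ : ℝ) (w : M → ℝ) (x : M) :
    backgroundPathOperator g t w x = backgroundPathOperator g t₀ w x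
      + ((1 - t) * (2 - t) - (1 - t₀) * (2 - t₀)) * backgroundScalar g w x ^ 2 / 6 := by
  simp only [backgroundPathOperator]
  ring

/-- **`∂_t F_t = (2t − 3)ρ_w²/6`** pointwise (the `t`-derivative entering the implicit function
theorem of §5). [folklore] -/
theorem hasDerivAt_backgroundPathOperator_param (t₀ : ℝ) (w : M → ℝ) (x : M) :
    HasDerivAt (fun t ↦ backgroundPathOperator g t w x)
      ((2 * t₀ - 3) * backgroundScalar g w x ^ 2 / 6) t₀ := by
  have hfun : (fun t ↦ backgroundPathOperator g t w x) = fun t ↦ backgroundPathOperator g t₀ w x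
      + ((1 - t) * (2 - t) - (1 - t₀) * (2 - t₀)) * backgroundScalar g w x ^ 2 / 6 :=
    funext fun t ↦ backgroundPathOperator_eq_add_sub g t t₀ w x
  rw [hfun]
  have h1 : HasDerivAt (fun t : ℝ ↦ (1 - t) * (2 - t)) (2 * t₀ - 3) t₀ := by
    have h : HasDerivAt (fun y : ℝ ↦ (1 - y) * (2 - y)) (-1 * (2 - t₀) + (1 - t₀) * -1) t₀ :=
      ((hasDerivAt_id t₀).const_sub 1).mul ((hasDerivAt_id t₀).const_sub 2)
    exact h.congr_deriv (by ring)
  have h2 := ((h1.sub_const ((1 - t₀) * (2 - t₀))).mul_const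
    (backgroundScalar g w x ^ 2)).div_const 6
  have h3 := h2.const_add (backgroundPathOperator g t₀ w x)
  convert h3 using 1

/-- **Uniform continuity in `t`**: on a compact `M`, for smooth `w`,
`backgroundPathOperator g t w → backgroundPathOperator g t₀ w` uniformly as `t → t₀`. [folklore] -/
theorem tendstoUniformly_backgroundPathOperator [CompactSpace M] {w : M → ℝ}
    (hw : ContMDiff (𝓡 4) 𝓘(ℝ) ∞ w) (t₀ : ℝ) :
    TendstoUniformly (fun t x ↦ backgroundPathOperator g t w x)
      (fun x ↦ backgroundPathOperator g t₀ w x) (𝓝 t₀) := by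
  -- `|F_t − F_{t₀}| ≤ |(1−t)(2−t) − (1−t₀)(2−t₀)|·sup ρ²/6`
  obtain ⟨C, hC0, hC⟩ : ∃ C, 0 ≤ C ∧ ∀ x, backgroundScalar g w x ^ 2 / 6 ≤ C := by
    have hcont : Continuous fun x ↦ backgroundScalar g w x ^ 2 / 6 :=
      ((contMDiff_backgroundScalar g hw).continuous.pow 2).div_const 6
    obtain ⟨C, hC⟩ := (isCompact_univ.image hcont).isBounded.bddAbove
    exact ⟨max C 0, le_max_right _ _,
      fun x ↦ (hC ⟨x, Set.mem_univ _, rfl⟩).trans (le_max_left _ _)⟩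
  rw [Metric.tendstoUniformly_iff]
  intro ε hε
  have hct : Tendsto (fun t : ℝ ↦ (1 - t) * (2 - t)) (𝓝 t₀) (𝓝 ((1 - t₀) * (2 - t₀))) :=
    ((continuous_const.sub continuous_id).mul (continuous_const.sub continuous_id)).tendsto t₀
  have hsmall : ∀ᶠ t in 𝓝 t₀, |(1 - t) * (2 - t) - (1 - t₀) * (2 - t₀)| < ε / (C + 1) := by
    have h := Metric.tendsto_nhds.1 hct (ε / (C + 1)) (by positivity)
    simpa [Real.dist_eq] using h
  filter_upwards [hsmall] with t ht x
  rw [Real.dist_eq, backgroundPathOperator_eq_add_sub g t t₀ w x]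
  have hρ := hC x
  have hρ0 : 0 ≤ backgroundScalar g w x ^ 2 / 6 := by positivity
  calc |backgroundPathOperator g t₀ w x - (backgroundPathOperator g t₀ w x
          + ((1 - t) * (2 - t) - (1 - t₀) * (2 - t₀)) * backgroundScalar g w x ^ 2 / 6)|
        = |(1 - t) * (2 - t) - (1 - t₀) * (2 - t₀)| * (backgroundScalar g w x ^ 2 / 6) := by
          rw [show backgroundPathOperator g t₀ w x - (backgroundPathOperator g t₀ w x
              + ((1 - t) * (2 - t) - (1 - t₀) * (2 - t₀)) * backgroundScalar g w x ^ 2 / 6)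
              = -(((1 - t) * (2 - t) - (1 - t₀) * (2 - t₀)) * (backgroundScalar g w x ^ 2 / 6)) by
              ring, abs_neg, abs_mul, abs_of_nonneg hρ0]
    _ ≤ ε / (C + 1) * C := mul_le_mul ht.le hρ (hρ0) (by positivity)
    _ < ε := by
          rw [div_mul_eq_mul_div, div_lt_iff₀ (by positivity)]
          nlinarith

end Smoothness

end Literature.Geometry.Riemannian.GurskyViaclovskyPath

end
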